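import Summits.RiemannHypothesis.RiemannHypothesis.Theses.SpectralTrace
import Summits.RiemannHypothesis.RiemannHypothesis.Theorems.SpectralTraceWindowCompactness
import Summits.RiemannHypothesis.RiemannHypothesis.Theorems.SpectralIsHpSpectrum.Negative.RefutationImpliesRH
import Summits.RiemannHypothesis.RiemannHypothesis.Theorems.WindowTraceArch.Negative.WithoutIsWeilTest
import Summits.RiemannHypothesis.RiemannHypothesis.Theorems.WindowTraceArch.Negative.ComplexSpectrum
import Literature.NumberTheory.LFunctions.WeilArchimedeanPositivityProofs
import Literature.NumberTheory.LFunctions.WeilCriterionProofs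
import HarnessLib

/-!
# `SpectralThesis` (stmt-RiemannHypothesis-0187): why it resists, and its load-bearing parts

Negative lemmas for the route target `X = SpectralThesis` of route SpectralTrace
(refuter / cdisprove seat; supports stmt-RiemannHypothesis-0187).

* `not_spectralThesis_iff` : `¬ X ↔ ¬ RH` — a refutation of the crux is a refutation of the
  Riemann hypothesis (from the landed `riemannHypothesis_of_trace` and
  `spectralThesis_of_riemannHypothesis`); no cheap falsity search can touch it.
* `spectralThesis_false_without_isWeilTest` : dropping the test-class hypothesis `IsWeilTest g`
  makes `X` FALSE (null spike `𝟙_{0}`).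
* `spectralThesisStrip_holds` : dropping REALNESS of the spectrum makes `X` a THEOREM, even with
  the spectrum confined to the open critical strip (the non-trivial zeros with multiplicity,
  `hasSum_weilMellin_zeros`): realness is the entire content.
* `spectralThesis_trivial_without_value` : dropping the VALUE `W g` (mere summability) makes it
  trivially true (empty family).
* `weightedSpectralThesis_iff_riemannHypothesis` : replacing unit masses by arbitrary positive
  real weights gives a statement again equivalent to RH — integrality is NOT what makes `X`
  RH-strength (its integrality content is the rigidity item `SpectralIsHpSpectrum`).
(The prime-side / bounded-translates analysis lives in `BoundedTranslates.lean`.)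
-/

noncomputable section

open Complex Set MeasureTheory Filter

namespace Summit.RiemannHypothesis.RiemannHypothesis.Theorems.SpectralThesis.Negative

open Literature.NumberTheory.LFunctions
open Summit.RiemannHypothesis.RiemannHypothesis.Theses.SpectralTrace
open Summit.RiemannHypothesis.RiemannHypothesis.Theorems
open Summit.RiemannHypothesis.RiemannHypothesis.Theorems.WindowTraceArch.Negative
open Summit.RiemannHypothesis.RiemannHypothesis.Theorems.SpectralIsHpSpectrum.Negative

/-- **`¬ X ↔ ¬ RH`**: a refutation of `SpectralThesis` is a refutation of the Riemann hypothesis,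
and conversely. [folklore] -/
theorem not_spectralThesis_iff : ¬ SpectralThesis ↔ ¬ _root_.RiemannHypothesis :=
  not_congr ⟨fun ⟨_, _, h⟩ => riemannHypothesis_of_trace h, spectralThesis_of_riemannHypothesis⟩

/-- **FALSE without `IsWeilTest`**: no real family satisfies the trace identity for ALL
`g : ℝ → ℂ` (witness `g = 𝟙_{0}`: all summands `0`, `W g = -log π`; landed window version
`windowTraceArch_false_without_isWeilTest`). [folklore] -/
theorem spectralThesis_false_without_isWeilTest :
    ¬ ∃ (ι : Type) (γ : ι → ℝ), ∀ g : ℝ → ℂ,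
      HasSum (fun i => weilMellin g (1 / 2 + (γ i : ℂ) * I)) (weilFunctional g) := by
  rintro ⟨ι, γ, h⟩
  exact windowTraceArch_false_without_isWeilTest ⟨ι, γ, fun g _ => h g⟩

/-- **TRUE without realness, spectrum in the open critical strip**: some complex family `s` with
`0 < Re s_i < 1` reproduces `W` on every Weil test (the non-trivial zeros with multiplicity). What
`X` adds to this theorem is exactly `Re s_i = 1/2`. [folklore] -/
theorem spectralThesisStrip_holds :
    ∃ (ι : Type) (s : ι → ℂ), (∀ i, 0 < (s i).re ∧ (s i).re < 1) ∧ ∀ g : ℝ → ℂ, IsWeilTest g →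
      HasSum (fun i => weilMellin g (s i)) (weilFunctional g) :=
  ⟨(Σ ρ : ZetaZeros.riemannZetaNontrivialZeros, Fin (riemannZetaZeroOrder (ρ : ℂ)).toNat),
    fun p => (p.1 : ℂ),
    fun p => ⟨ZetaZeros.riemannZetaNontrivialZeros.re_pos p.1.2,
      ZetaZeros.riemannZetaNontrivialZeros.re_lt_one p.1.2⟩,
    fun _ hg => hasSum_weilMellin_zeros hg⟩

/-- **TRIVIAL without the value**: with `HasSum … (W g)` weakened to `Summable`, the empty family
works. [folklore] -/
theorem spectralThesis_trivial_without_value :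
    ∃ (ι : Type) (γ : ι → ℝ), ∀ g : ℝ → ℂ, IsWeilTest g →
      Summable (fun i => weilMellin g (1 / 2 + (γ i : ℂ) * I)) :=
  ⟨PEmpty, fun i => i.elim, fun _ _ => summable_empty⟩

/-- **Integrality is not load-bearing for the RH-equivalence**: the weighted relaxation of `X`
(positive real masses `c_i` instead of unit masses) is again equivalent to RH — positivity of
`Q(g) = Σ_i c_i |ĝ(1/2+iγ_i)|²` needs only `c_i > 0` (`weil_criterion_holds`), and RH gives unit
weights (`spectralThesis_of_riemannHypothesis`). [folklore] -/
theorem weightedSpectralThesis_iff_riemannHypothesis :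
    (∃ (ι : Type) (γ : ι → ℝ) (c : ι → ℝ), (∀ i, 0 < c i) ∧ ∀ g : ℝ → ℂ, IsWeilTest g →
      HasSum (fun i => (c i : ℂ) * weilMellin g (1 / 2 + (γ i : ℂ) * I)) (weilFunctional g)) ↔
      _root_.RiemannHypothesis := by
  constructor
  · rintro ⟨ι, γ, c, hc, h⟩
    refine (show _root_.RiemannHypothesis ↔ WeilPositivity from weil_criterion_holds).2
      fun g hg => ?_
    have hk : IsWeilTest (weilConv g (weilReflect g)) := hg.weilConv hg.weilReflect
    have hs := h _ hk
    have hs' : HasSum (fun i => ((c i * ‖weilMellin g (1 / 2 + (γ i : ℂ) * I)‖ ^ 2 : ℝ) : ℂ))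
        (weilQuadratic g) := by
      unfold weilQuadratic
      simpa only [weilMellin_weilConv_weilReflect_half hg, ← Complex.ofReal_mul] using hs
    have hre := hs'.mapL Complex.reCLM
    simp only [Complex.reCLM_apply, Complex.ofReal_re] at hre
    exact hre.nonneg fun i => mul_nonneg (hc i).le (by positivity)
  · intro hRH
    obtain ⟨ι, γ, h⟩ := spectralThesis_of_riemannHypothesis hRH
    exact ⟨ι, γ, fun _ => 1, fun _ => one_pos, fun g hg => by simpa using h g hg⟩

end Summit.RiemannHypothesis.RiemannHypothesis.Theorems.SpectralThesis.Negative

end
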